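import Literature.Topology.FourManifolds.LargeKTrisectionClassification
import Literature.Topology.FourManifolds.TrisectionShrink
import Literature.Topology.FourManifolds.ConnectedSumSphereIdentity
import Literature.Topology.FourManifolds.HomotopyS4CompactProofs
import HarnessLib

/-!
# The Meier–Schirmer–Zupan classification fact: universe bookkeeping (PROVED)

Topic `Literature/Topology/FourManifolds`, proofs companion of `LargeKTrisectionClassification.lean`
(the named fact `msz_trisection_classification_gk`, Meier–Schirmer–Zupan 2016 Thm. 1.2, and the
class `IsCircleProdSum n P`, "`P` is a connected sum of `n` copies of `S¹ × S³`"; the fact is NOT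
discharged here).  In the style of `ReducibleTrisectionSplittingUniv.lean` and
`TrisectionShrink.lean`.

The fact quantifies over a trisected closed smooth `X : Type u` AND concludes, in its second
alternative, with the existence of a summand `M : Type u`; the class `IsCircleProdSum n P` is an
inductive family whose intermediate summands live in the universe of `P`.  A discharge must hold
at every universe while any proof builds its models in `Type 0`.  Here both are shown to be
universe-free:

* `IsCircleProdSum.of_diffeomorph_univ` — **`IsCircleProdSum n P` moves along a diffeomorphism
  `P ≅ P′` into ANY universe** (induction on `n`: at `0` compose the diffeomorphisms with `S⁴`; at
  `n + 1` move the glued manifold along `P ≅ P′` (`IsConnectedSum.of_diffeomorph`) and the summand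
  `M : Type u` to its small copy `Shrink.{w} M` (`ManifoldShrink.lean`,
  `IsConnectedSum.of_diffeomorph_left`), which is again a connected sum of `n` copies by the
  induction hypothesis); `IsCircleProdSum.shrink_iff`.
* `msz_trisection_classification_gk_of_univ`, `msz_trisection_classification_gk_univ_iff` — **the
  fact at one universe gives it at every universe**: move `X` with its trisection (pieces shrunk,
  `IsGKTrisection.preimage_diffeomorph`) and orientation to `Shrink.{v} X`, apply the fact, and move
  both alternatives of the conclusion back (`IsCircleProdSum.of_diffeomorph_univ`; the summand `M`
  of the `ℂP²`-alternative to `Shrink.{u} M`, the relation along `IsConnectedSum.of_diffeomorph`,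
  `.of_diffeomorph_left`; the summand `ℂP² : Type` is fixed).

So a discharge of `msz_trisection_classification_gk.{0}` discharges it everywhere (and, through
`Literature/Barriers/SmoothPoincare4/LowGenusTrisectionsStandardOfClassification.lean`, the
homotopy-sphere facts `msz_homotopySphere_gk`, `mz_genus_le_two_homotopySphere_gk` at every
universe).  Everything here is proved; no definition, no named fact.

## References

* J. Meier, T. Schirmer, A. Zupan, *Classification of trisections and the Generalized Property R
  Conjecture*, Proc. AMS 144 (2016) 4983–4997 (arXiv:1507.06561), Thm. 1.2. [MeierSchirmerZupan2016]
* M. Kervaire, J. Milnor, *Groups of homotopy spheres I*, Ann. of Math. 77 (1963), §2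
  (connected sum well defined up to diffeomorphism of the pieces). [KervaireMilnor1963]
-/

noncomputable section

open scoped Manifold ContDiff Topology
open Set

namespace Literature.Topology.FourManifolds

universe u v w

/-! ### `IsCircleProdSum` across universes -/

/-- **`IsCircleProdSum n P` is invariant under diffeomorphisms onto manifolds of any universe.**
By induction on `n`: for `n = 0` compose `P′ ≅ P ≅ S⁴`; for `n + 1`, `P = M # (S¹ × S³)` with
`IsCircleProdSum n M`, `M : Type u`; the relation moves along `P ≅ P′`
(`IsConnectedSum.of_diffeomorph`) and along `M ≅ Shrink.{w} M` in the left slot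
(`IsConnectedSum.of_diffeomorph_left`, `ManifoldShrink.diffeomorph`), and `Shrink.{w} M` is a
connected sum of `n` copies by the induction hypothesis. [cite: KervaireMilnor1963, §2] -/
theorem IsCircleProdSum.of_diffeomorph_univ {n : ℕ} :
    ∀ {P : Type u} [TopologicalSpace P] [ChartedSpace (EuclideanSpace ℝ (Fin 4)) P]
      (_ : IsCircleProdSum n P) {P' : Type w} [TopologicalSpace P']
      [ChartedSpace (EuclideanSpace ℝ (Fin 4)) P'] [IsManifold (𝓡 4) ∞ P']
      (_ : P ≃ₘ⟮𝓡 4, 𝓡 4⟯ P'), IsCircleProdSum n P' := by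
  induction n with
  | zero =>
    intro P _ _ h P' _ _ _ e
    obtain ⟨e₀⟩ := isCircleProdSum_zero_iff.mp h
    exact .sphere (e.symm.trans e₀)
  | succ n ih =>
    intro P _ _ h P' _ _ _ e
    obtain ⟨M, _, _, _, _, _, _, _, hM, hsum⟩ := isCircleProdSum_succ_iff.mp h
    haveI : Small.{w} M := small_of_secondCountableTopology M
    let φ : Shrink.{w} M ≃ₘ⟮𝓡 4, 𝓡 4⟯ M := ManifoldShrink.diffeomorph (𝓡 4) M ∞
    exact .succ (ih hM φ.symm) ((hsum.of_diffeomorph e).of_diffeomorph_left φ.symm)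

/-- In particular `IsCircleProdSum n P` at `P : Type u` and at its small copy `Shrink.{w} P` are
equivalent. [cite: KervaireMilnor1963, §2] -/
theorem IsCircleProdSum.shrink_iff {n : ℕ} {P : Type u} [TopologicalSpace P] [T2Space P]
    [SecondCountableTopology P] [ChartedSpace (EuclideanSpace ℝ (Fin 4)) P] [IsManifold (𝓡 4) ∞ P]
    [Small.{w} P] :
    IsCircleProdSum n (Shrink.{w} P) ↔ IsCircleProdSum n P :=
  ⟨fun h => h.of_diffeomorph_univ (ManifoldShrink.diffeomorph (𝓡 4) P ∞),
    fun h => h.of_diffeomorph_univ (ManifoldShrink.diffeomorph (𝓡 4) P ∞).symm⟩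

/-! ### The classification fact across universes -/

/-- **`msz_trisection_classification_gk` at one universe gives it at every universe** (PROVED).
Given a `(g; k)`-trisected closed connected oriented smooth `X : Type u` with `g ≤ k 0 + 1`: `X` is
`v`-small (`small_of_secondCountableTopology`), `Shrink.{v} X` carries the transported smooth
structure and orientation (`ManifoldShrink.lean`) and the trisection with its pieces shrunk
(`IsGKTrisection.preimage_diffeomorph`, same type `(g; k)`); the fact at universe `v` makes
`Shrink X` a connected sum of `k′` copies of `S¹ × S³` — then so is `X`
(`IsCircleProdSum.of_diffeomorph_univ`) — or a connected sum `M # ℂP²` with `M : Type v` a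
connected sum of `k′` copies — then `X = (Shrink.{u} M) # ℂP²` (`IsConnectedSum.of_diffeomorph`,
`.of_diffeomorph_left`) with `IsCircleProdSum k′ (Shrink.{u} M)`.
[cite: MeierSchirmerZupan2016, Thm. 1.2] [cite: KervaireMilnor1963, §2] -/
theorem msz_trisection_classification_gk_of_univ (h : msz_trisection_classification_gk.{v}) :
    msz_trisection_classification_gk.{u} := by
  intro X _ _ _ _ _ _ _ o g k S hT hk
  haveI : Small.{v} X := small_of_secondCountableTopology X
  let ψ : Shrink.{v} X ≃ₘ⟮𝓡 4, 𝓡 4⟯ X := ManifoldShrink.diffeomorph (𝓡 4) X ∞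
  have hT' : IsGKTrisection (Shrink.{v} X) g k (fun i => ψ.symm '' S i) := by
    simpa only [Diffeomorph.symm_image_eq_preimage] using hT.preimage_diffeomorph ψ
  rcases h (Shrink.{v} X) (ManifoldShrink.orientation o) g k _ hT' hk with
    hX | ⟨M, _, _, _, _, _, _, _, hM, hsum⟩
  · exact Or.inl (hX.of_diffeomorph_univ ψ)
  · haveI : Small.{u} M := small_of_secondCountableTopology M
    let φ : Shrink.{u} M ≃ₘ⟮𝓡 4, 𝓡 4⟯ M := ManifoldShrink.diffeomorph (𝓡 4) M ∞
    exact Or.inr ⟨Shrink.{u} M, inferInstance, inferInstance, inferInstance, inferInstance,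
      inferInstance, inferInstance, inferInstance, hM.of_diffeomorph_univ φ.symm,
      (hsum.of_diffeomorph ψ).of_diffeomorph_left φ.symm⟩

/-- `msz_trisection_classification_gk` does not depend on the universe.
[cite: MeierSchirmerZupan2016, Thm. 1.2] -/
theorem msz_trisection_classification_gk_univ_iff :
    msz_trisection_classification_gk.{u} ↔ msz_trisection_classification_gk.{v} :=
  ⟨msz_trisection_classification_gk_of_univ, msz_trisection_classification_gk_of_univ⟩

end Literature.Topology.FourManifolds

end
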